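import Summits.Langlands.Langlands.Theses.ParityBlindBianchi
import Literature.NumberTheory.GaloisRepresentations.PolarizedDeformationRing
import HarnessLib

/-!
# Route `ParityBlindBianchi`, crux `TwoAdicBianchiProModularityLevel` (stmt-Langlands-15110): vocabulary of
# the line `dimension-squeeze`

Route-posited objects (D-0016 `<Route><Crux>Defs`-type file, same convention as
`SkinnerWilesDefectOneReducibleOrdinaryProModularDefs.lean`) shared by the five registered stubs of the checked
skeleton `Cruxes/TwoAdicBianchiProModularityLevel/Lines/dimension_squeeze.lean` (v2, lead
prover-line-stmt-Langlands-15110-c14, registered 2026-08-17 by `ledger skeleton check`: stubs `stub_setup`,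
`stub_galoisDomain`, `stub_heckeDimension`, `stub_zariskiReadout`, `stub_classicalHeckePoint`) and by the crux
file that will compose them.  NOTHING IS ASSERTED: every `def … : Prop` below is a *statement* consumed only as
(part of) the type of a stub theorem; the `Type`-valued `Model` bundles EXISTING tree vocabulary (a coefficient
ring of Mazur's category embedded in `𝒪_{ℚ̄₂}`, an integral model of a conjugate of `σ`, the tree's
`PolarizedDatum` / `PolarizedDeformationRing` interface) and introduces no axiom; the ideals `typeIdeal`,
`typeLocusIdeal`, `heckeIdeal` and the point sets `typePoints`, `heckePoints` are plain data.  Declared in the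
skeleton's namespace `Summit.Langlands.Langlands.Cruxes.TwoAdicBianchiProModularityLevel.DimensionSqueeze`, so
that a landed stub `theorem stub_<name> : <registered signature>` reads byte-identically to its registration
(the skeleton is reshaped to import this file in place of its inline copies).

THE LINE (Gouvêa–Mazur–Böckle transplanted to defect `l₀ = 1`, with the infinite fern REPLACED by torsion
dimension; card `Lines/dimension-squeeze.md`): with `R` Mazur's universal deformation ring of `σ̄` unramified
outside the bad set (`Θ = ∅` datum), `I^θ = typeLocusIdeal` the ideal of the Zariski closure of the
characteristic-`0` deformations of determinant `det σ` and inertial type `σ|_{I_w}` at the odd bad places, and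
`J_U = heckeIdeal U` the ideal of the closure of the type-`θ` HECKE points (those whose Galois representation
has Hansen data forming a point of `Spf 𝕋(U²)` of the `2`-power Bianchi tower):
`B ⇐ [R ⧸ I^θ is a domain of Krull dim ≤ 4] ∧ [dim R ⧸ J_U ≥ 4 for some tame U] ∧ [J_U ≤ I^θ ⇒ σ IsHeckePoint]`.

Objects: `O2`, `O2.incl` (`𝒪_{ℚ̄₂} ⊆ ℚ̄₂`); `Good`, `badSet`, `badSet_finite`; `IsTameLevel` (the crux's three
level clauses); `IsPointAt` (the crux's `IsHeckePoint` clause); `IsAssocBare` (bare Hansen association);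
`Model` (+ `residual`, `datum`, `isUnramifiedAt_σ𝒪`, `isUnramifiedAt_residual`); `typeIdeal`, `pointRep`,
`typePoints`, `typeLocusIdeal`, `heckePoints`, `heckeIdeal` (+ the two order lemmas
`typeLocusIdeal_le_heckeIdeal`, `typeIdeal_le_typeLocusIdeal`); `generalLinearGroup_map_injective`,
`isUnramifiedAt_map` (kernel-checked plumbing used by the stubs' proofs).

References: Mazur1997Deformation §20, §26; KisinModuli2009 §2.3; CalegariEmerton2011 §8;
HansenUniversalEigenvarieties2017 Def. 1.2.1; SerreAbelianLadic1968 I.1.1; the line card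
`Cruxes/TwoAdicBianchiProModularityLevel/Lines/dimension-squeeze.md` and the v1-GAL dossier
`Lines/dimension-squeeze-GALv1-false.md`.
-/

noncomputable section

set_option linter.dupNamespace false -- `Summit.Langlands.Langlands` is the mandated namespace (D-0017)

open scoped NumberField MatrixGroups
open Polynomial IsDedekindDomain Field
open Literature.NumberTheory.GaloisRepresentations Literature.NumberTheory.Automorphic

namespace Summit.Langlands.Langlands.Cruxes.TwoAdicBianchiProModularityLevel.DimensionSqueeze

/-! ### Vocabulary -/

/-- `𝒪_{ℚ̄₂}`, the valuation ring of `ℚ̄₂` (the coefficient ring of the crux's Hecke points).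
[folklore] -/
abbrev O2 : Type := (PadicAlgCl.valued 2).v.valuationSubring

/-- The inclusion `𝒪_{ℚ̄₂} ⊆ ℚ̄₂`. [folklore] -/
abbrev O2.incl : O2 →+* PadicAlgCl 2 := (PadicAlgCl.valued 2).v.valuationSubring.subtype

section Vocabulary

variable (K : Type) [Field K] [NumberField K]

/-- The good places: finite places of `K` over no element of `S₀`. [folklore] -/
abbrev Good (S₀ : Finset ℕ) : Type :=
  {v : HeightOneSpectrum (𝓞 K) // ∀ ℓ ∈ S₀, ((ℓ : ℕ) : 𝓞 K) ∉ v.asIdeal}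

/-- The bad places: finite places of `K` over some element of `S₀`. [folklore] -/
def badSet (S₀ : Finset ℕ) : Set (HeightOneSpectrum (𝓞 K)) :=
  {v | ¬ ∀ ℓ ∈ S₀, ((ℓ : ℕ) : 𝓞 K) ∉ v.asIdeal}

/-- **Tame level of type `S₀`** (the crux's three level clauses): `U` open, `U ≤ GL₂(𝒪̂_K)`, and
`U` contains every integral `g` which is trivial at the bad places — so `U` is hyperspecial at the
good places and free over `S₀`. [folklore] -/
def IsTameLevel (S₀ : Finset ℕ) (U : Subgroup (GL (Fin 2) (FiniteAdeleRing (𝓞 K) K))) : Prop :=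
  IsOpen (U : Set (GL (Fin 2) (FiniteAdeleRing (𝓞 K) K))) ∧
  U ≤ glFiniteIntegralLevel 2 K ∧
  (∀ g ∈ glFiniteIntegralLevel 2 K,
    (∀ v : HeightOneSpectrum (𝓞 K), ¬ (∀ ℓ ∈ S₀, ((ℓ : ℕ) : 𝓞 K) ∉ v.asIdeal) →
      ∀ i j : Fin 2, ((g : Matrix (Fin 2) (Fin 2) (FiniteAdeleRing (𝓞 K) K)) i j) v =
        (1 : Matrix (Fin 2) (Fin 2) (v.adicCompletion K)) i j) → g ∈ U)

/-- **`a` is a point of `Spf 𝕋(U²)`** (the crux's `IsHeckePoint` clause verbatim): the family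
`a_{v,i}`, `v` good, `i = 1, 2`, is a continuous `𝒪_{ℚ̄₂}`-point of the big Hecke algebra of the
`2`-power Bianchi tower of tame level `U`, for the Hecke elements `diag(ϖ_v,1)`, `diag(ϖ_v,ϖ_v)`.
[cite: CalegariEmerton2011, §8] -/
def IsPointAt (S₀ : Finset ℕ) (U : Subgroup (GL (Fin 2) (FiniteAdeleRing (𝓞 K) K)))
    (ϖ : ∀ v : HeightOneSpectrum (𝓞 K), (v.adicCompletion K)ˣ) (a : Good K S₀ → ℕ → O2) : Prop :=
  IsHeckePoint
    (Matrix.GeneralLinearGroup.map (algebraMap K (FiniteAdeleRing (𝓞 K) K)) :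
      GL (Fin 2) K →* GL (Fin 2) (FiniteAdeleRing (𝓞 K) K))
    (LevelTower.ofSeq U (fun r : ℕ =>
      (principalCongruenceLevel 2 K (Ideal.span {((2 : ℕ) : 𝓞 K)} ^ r)).map (GLn.sndHom 2 K)))
    ((2 : ℕ) : O2)
    (fun j : Good K S₀ × Fin 2 => GLn.sndHom 2 K (heckeDiagAt 2 K j.1.1 (ϖ j.1.1) (j.2.val + 1)))
    (fun j => a j.1 (j.2.val + 1))

/-- **Bare Hansen association** of a homomorphism `ρ : Γ_K → GL₂(ℚ̄₂)` with `t` at `v` (the tree's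
`FramedGaloisRep.IsHeckeAssociatedAt` without the continuity wrapper): `ρ` unramified at `v` and
`charpoly ρ(Frob⁻¹) = X² − t₁ X + q_v t₂` at every arithmetic Frobenius.
[cite: HansenUniversalEigenvarieties2017, Def. 1.2.1] -/
def IsAssocBare (ρ : absoluteGaloisGroup K →* GL (Fin 2) (PadicAlgCl 2)) (v : HeightOneSpectrum (𝓞 K))
    (t : ℕ → PadicAlgCl 2) : Prop :=
  Deformation.IsUnramifiedAt v ρ ∧
    ∀ 𝔓 ∈ v.primesAbove, ∀ g : absoluteGaloisGroup K, IsArithFrobAt (𝓞 K) g 𝔓 →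
      ((ρ g⁻¹ : GL (Fin 2) (PadicAlgCl 2)) : Matrix (Fin 2) (Fin 2) (PadicAlgCl 2)).charpoly =
        heckeFrobPoly v.residueCard 2 t

/-- The bad set is finite as soon as `0 ∉ S₀` (finitely many places over each non-zero `ℓ`).
[folklore] -/
theorem badSet_finite (S₀ : Finset ℕ) (h0 : (0 : ℕ) ∉ S₀) : (badSet K S₀).Finite := by
  have hsub : badSet K S₀ ⊆ ⋃ ℓ ∈ S₀, {v : HeightOneSpectrum (𝓞 K) | ((ℓ : ℕ) : 𝓞 K) ∈ v.asIdeal} := by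
    intro v hv
    simp only [badSet, Set.mem_setOf_eq, not_forall, not_not, exists_prop] at hv
    obtain ⟨ℓ, hℓ, hv⟩ := hv
    exact Set.mem_biUnion hℓ hv
  refine Set.Finite.subset (Set.Finite.biUnion S₀.finite_toSet fun ℓ hℓ => ?_) hsub
  have hℓ0 : ((ℓ : ℕ) : 𝓞 K) ≠ 0 := by
    have : ℓ ≠ 0 := fun h => h0 (h ▸ hℓ)
    exact_mod_cast this
  have hI : (Ideal.span {((ℓ : ℕ) : 𝓞 K)} : Ideal (𝓞 K)) ≠ 0 := by
    rw [Ne, Submodule.zero_eq_bot, Ideal.span_singleton_eq_bot]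
    exact hℓ0
  refine (Ideal.finite_factors hI).subset fun v hv => ?_
  simp only [Set.mem_setOf_eq] at hv ⊢
  exact (Ideal.dvd_span_singleton).mpr hv

end Vocabulary

/-! ### Integral models and the deformation datum -/

/-- **An integral model of `σ`** over a coefficient ring of Mazur's category: a complete Noetherian
discrete valuation ring `𝒪` over `ℤ₂` with finite residue field `k` of characteristic `2`, embedded in `𝒪_{ℚ̄₂}`,
and `σ𝒪 : Γ_K → GL₂(𝒪)` mapping to a CONJUGATE `P⁻¹ σ P` of `σ` (lead c14 reshape: the crux's `σ` is an
arbitrary continuous framing, whose entries need not be `2`-adic integers — only a conjugate by the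
matrix of a stable lattice is integral, Serre *Abelian ℓ-adic representations* I.1.1), with open kernel
(and open kernel residually).  Exists for every continuous `σ` with finite image (`stub_setup`).
[cite: Mazur1997Deformation, §20] [cite: SerreAbelianLadic1968, Ch. I §1.1, Remark 1] -/
structure Model {K : Type} [Field K] [NumberField K] (σ : FramedGaloisRep K (PadicAlgCl 2) 2) :
    Type 1 where
  /-- The coefficient ring. -/
  𝒪 : Type
  [instCommRing : CommRing 𝒪]
  [instIsDomain : IsDomain 𝒪]
  [instIsDiscreteValuationRing : IsDiscreteValuationRing 𝒪]
  [instIsLocalRing : IsLocalRing 𝒪]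
  [instIsNoetherianRing : IsNoetherianRing 𝒪]
  [instIsAdicComplete : IsAdicComplete (IsLocalRing.maximalIdeal 𝒪) 𝒪]
  [instAlgebra : Algebra ℤ_[2] 𝒪]
  /-- The residue field. -/
  k : Type
  [instField : Field k]
  [instFinite : Finite k]
  [instCharP : CharP k 2]
  [instAlgebraK : Algebra 𝒪 k]
  /-- `𝒪 → k` is onto. -/
  residue_surjective : Function.Surjective (algebraMap 𝒪 k)
  /-- The embedding into `𝒪_{ℚ̄₂}`. -/
  emb : 𝒪 →+* O2
  /-- The embedding is injective. -/
  emb_injective : Function.Injective emb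
  /-- The model. -/
  σ𝒪 : absoluteGaloisGroup K →* GL (Fin 2) 𝒪
  /-- The frame change: the matrix of a `Γ_K`-stable lattice. -/
  frame : GL (Fin 2) (PadicAlgCl 2)
  /-- The model maps to the conjugate `P⁻¹ σ P` of `σ` (the tree's integral-model convention,
  `exists_integralModel_of_valuationSubring`). -/
  map_σ𝒪 : ∀ g : absoluteGaloisGroup K,
    Matrix.GeneralLinearGroup.map (O2.incl.comp emb) (σ𝒪 g) = frame⁻¹ * σ g * frame
  /-- The model has open kernel. -/
  isOpen_ker : IsOpen ((σ𝒪.ker : Set (absoluteGaloisGroup K)))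
  /-- The residual representation has open kernel. -/
  isOpen_ker_residual :
    IsOpen ((((Matrix.GeneralLinearGroup.map (algebraMap 𝒪 k)).comp σ𝒪).ker : Set (absoluteGaloisGroup K)))

namespace Model

attribute [instance] instCommRing instIsDomain instIsDiscreteValuationRing instIsLocalRing
  instIsNoetherianRing instIsAdicComplete instAlgebra instField instFinite instCharP instAlgebraK

variable {K : Type} [Field K] [NumberField K] {σ : FramedGaloisRep K (PadicAlgCl 2) 2} (M : Model σ)

/-- The residual representation `σ̄ : Γ_K → GL₂(k)`. [folklore] -/
def residual : absoluteGaloisGroup K →* GL (Fin 2) M.k :=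
  (Matrix.GeneralLinearGroup.map (algebraMap M.𝒪 M.k)).comp M.σ𝒪

/-- **The deformation datum of `σ`**: Mazur's "unramified outside `S`" problem for `σ̄` over `K`
(`F₀ = F = K`, NO polarisation: `Θ = ∅`), `S` = the places of `K` over `S₀ ∋ 2`.
[cite: Mazur1997Deformation, §26 Prop. 1] -/
def datum (S₀ : Finset ℕ) (h0 : (0 : ℕ) ∉ S₀) (h2 : 2 ∈ S₀)
    (hunr : ∀ v ∉ badSet K S₀, Deformation.IsUnramifiedAt v M.residual) :
    PolarizedDatum K K 2 2 M.𝒪 M.k where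
  residueMap_surjective := M.residue_surjective
  S := badSet K S₀
  S_finite := badSet_finite K S₀ h0
  mem_S_of_mem := fun _ hv hgood => hgood 2 h2 hv
  residual := M.residual
  isOpen_ker_residual := M.isOpen_ker_residual
  residual_unramified := hunr
  Θ := ∅
  m := 0
  residual_polarized := fun _ hc => False.elim hc

variable {S₀ : Finset ℕ} {h0 : (0 : ℕ) ∉ S₀} {h2 : 2 ∈ S₀}
  {hunr : ∀ v ∉ badSet K S₀, Deformation.IsUnramifiedAt v M.residual}

/-- **The type ideal `I_θ` of `σ`** in the universal ring `R` (lead c14 reshape, v2): generated by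
`det ρ^univ(g) − det σ(g)` (`g ∈ Γ_K`: fixed determinant), by the entries of `ρ^univ(g) − 1` for
`g` in an inertia group at an ODD bad place with `σ(g) = 1` (`σ`-minimality: no more ramification
than `σ` away from `2`), AND by `tr ρ^univ(g) − tr σ(g)` for `g` in an inertia group at an odd bad
place (the INERTIAL TYPE of `σ` is pinned: without these trace generators the quotient has the two
`𝒪`-points `x_σ`, `x_{σ ⊗ χ}` for a quadratic `χ` ramified at an odd bad place where `σ(I_w) ∋ −1`,
on which the finite-order element `ρ^univ(τ)` has traces `−2 ≠ 2`, so it is never a domain — see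
`Lines/dimension-squeeze-GALv1-false.md`); nothing is imposed at the places over `2`.  All three
families are frame-independent (`det`, `tr`, and `σ(g) = 1`). [cite: KisinModuli2009, §2.3] -/
def typeIdeal (𝓡 : PolarizedDeformationRing (M.datum S₀ h0 h2 hunr)) : Ideal 𝓡.R :=
  Ideal.span
    ({x | ∃ g : absoluteGaloisGroup K,
        x = ((𝓡.ρ g : GL (Fin 2) 𝓡.R) : Matrix (Fin 2) (Fin 2) 𝓡.R).det -
          algebraMap M.𝒪 𝓡.R ((M.σ𝒪 g : GL (Fin 2) M.𝒪) : Matrix (Fin 2) (Fin 2) M.𝒪).det} ∪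
     {x | ∃ (v : HeightOneSpectrum (𝓞 K)) (𝔓 : Ideal (absIntegers (𝓞 K) K))
          (g : absoluteGaloisGroup K) (i j : Fin 2),
        v ∈ badSet K S₀ ∧ ((2 : ℕ) : 𝓞 K) ∉ v.asIdeal ∧ 𝔓 ∈ v.primesAbove ∧
        g ∈ 𝔓.inertia (absoluteGaloisGroup K) ∧ M.σ𝒪 g = 1 ∧
        x = ((𝓡.ρ g : GL (Fin 2) 𝓡.R) : Matrix (Fin 2) (Fin 2) 𝓡.R) i j -
          (1 : Matrix (Fin 2) (Fin 2) 𝓡.R) i j} ∪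
     {x | ∃ (v : HeightOneSpectrum (𝓞 K)) (𝔓 : Ideal (absIntegers (𝓞 K) K))
          (g : absoluteGaloisGroup K),
        v ∈ badSet K S₀ ∧ ((2 : ℕ) : 𝓞 K) ∉ v.asIdeal ∧ 𝔓 ∈ v.primesAbove ∧
        g ∈ 𝔓.inertia (absoluteGaloisGroup K) ∧
        x = ((𝓡.ρ g : GL (Fin 2) 𝓡.R) : Matrix (Fin 2) (Fin 2) 𝓡.R).trace -
          algebraMap M.𝒪 𝓡.R ((M.σ𝒪 g : GL (Fin 2) M.𝒪) : Matrix (Fin 2) (Fin 2) M.𝒪).trace})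

/-- The Galois representation `Γ_K → GL₂(ℚ̄₂)` of an `𝒪_{ℚ̄₂}`-point `φ` of `R`:
`φ ∘ ρ^univ`. [folklore] -/
def pointRep (𝓡 : PolarizedDeformationRing (M.datum S₀ h0 h2 hunr)) (φ : 𝓡.R →+* O2) :
    absoluteGaloisGroup K →* GL (Fin 2) (PadicAlgCl 2) :=
  (Matrix.GeneralLinearGroup.map (O2.incl.comp φ)).comp 𝓡.ρ

/-- **The type-`θ` points of `R`**: the `𝒪`-algebra points `φ : R → 𝒪_{ℚ̄₂}` (`φ` restricted to
`𝒪` is the fixed embedding) killing the type ideal — the characteristic-`0` deformations of `σ̄`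
unramified outside `S` with determinant `det σ` and the inertial type of `σ` at the odd bad places
(`x_σ` is one of them). [cite: KisinModuli2009, §2.3] -/
def typePoints (𝓡 : PolarizedDeformationRing (M.datum S₀ h0 h2 hunr)) : Set (𝓡.R →+* O2) :=
  {φ | φ.comp (algebraMap M.𝒪 𝓡.R) = M.emb ∧ M.typeIdeal 𝓡 ≤ RingHom.ker φ}

/-- **The type locus ideal** (lead c14 reshape, v2): the functions on `Spec R` vanishing at every
type-`θ` point, i.e. the ideal of the ZARISKI CLOSURE of the characteristic-`0` type-`θ` locus —
Kisin's reduced, `2`-torsion-free typed quotient `R^θ := R ⧸ (⨅ ker φ) ↪ ∏_φ 𝒪_{ℚ̄₂}`, immune to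
the `2`-torsion / nilpotent components of the naive quotient `R ⧸ I_θ`. [cite: KisinModuli2009, §2.3] -/
def typeLocusIdeal (𝓡 : PolarizedDeformationRing (M.datum S₀ h0 h2 hunr)) : Ideal 𝓡.R :=
  ⨅ φ ∈ M.typePoints 𝓡, RingHom.ker φ

/-- **The type-`θ` Hecke points of `R` at tame level `U`**: the type-`θ` points `φ` whose Galois
representation `φ ∘ ρ^univ` is Hansen-associated, at every good place, with a family of
eigenvalues forming a point of `Spf 𝕋(U²)` of the `2`-power Bianchi tower.
[cite: HansenUniversalEigenvarieties2017, Def. 1.2.1] -/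
def heckePoints (𝓡 : PolarizedDeformationRing (M.datum S₀ h0 h2 hunr))
    (U : Subgroup (GL (Fin 2) (FiniteAdeleRing (𝓞 K) K)))
    (ϖ : ∀ v : HeightOneSpectrum (𝓞 K), (v.adicCompletion K)ˣ) : Set (𝓡.R →+* O2) :=
  {φ | φ ∈ M.typePoints 𝓡 ∧
    ∃ b : Good K S₀ → ℕ → O2,
      (∀ (v : HeightOneSpectrum (𝓞 K)) (hv : ∀ ℓ ∈ S₀, ((ℓ : ℕ) : 𝓞 K) ∉ v.asIdeal),
        IsAssocBare K (M.pointRep 𝓡 φ) v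
          (fun i : ℕ => if i = 0 then (1 : PadicAlgCl 2) else (b ⟨v, hv⟩ i : PadicAlgCl 2))) ∧
      IsPointAt K S₀ U ϖ b}

/-- **The Hecke ideal `J_U`**: the functions on `Spec R` vanishing at every type-`θ` Hecke point of
level `U` (so `V(J_U)` is their Zariski closure). [folklore] -/
def heckeIdeal (𝓡 : PolarizedDeformationRing (M.datum S₀ h0 h2 hunr))
    (U : Subgroup (GL (Fin 2) (FiniteAdeleRing (𝓞 K) K)))
    (ϖ : ∀ v : HeightOneSpectrum (𝓞 K), (v.adicCompletion K)ˣ) : Ideal 𝓡.R :=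
  ⨅ φ ∈ M.heckePoints 𝓡 U ϖ, RingHom.ker φ

/-- Hecke points are type points. [folklore] -/
theorem heckePoints_subset_typePoints (𝓡 : PolarizedDeformationRing (M.datum S₀ h0 h2 hunr))
    (U : Subgroup (GL (Fin 2) (FiniteAdeleRing (𝓞 K) K)))
    (ϖ : ∀ v : HeightOneSpectrum (𝓞 K), (v.adicCompletion K)ˣ) :
    M.heckePoints 𝓡 U ϖ ⊆ M.typePoints 𝓡 := fun _ hφ => hφ.1

/-- The type locus ideal is below the Hecke ideal (`V(J_U) ⊆ V(I^θ)`: the Zariski closure of the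
Hecke points lies in the type locus). [folklore] -/
theorem typeLocusIdeal_le_heckeIdeal (𝓡 : PolarizedDeformationRing (M.datum S₀ h0 h2 hunr))
    (U : Subgroup (GL (Fin 2) (FiniteAdeleRing (𝓞 K) K)))
    (ϖ : ∀ v : HeightOneSpectrum (𝓞 K), (v.adicCompletion K)ˣ) :
    M.typeLocusIdeal 𝓡 ≤ M.heckeIdeal 𝓡 U ϖ := by
  refine le_iInf₂ fun φ hφ => ?_
  exact iInf₂_le φ (M.heckePoints_subset_typePoints 𝓡 U ϖ hφ)

/-- The type ideal is below the type locus ideal. [folklore] -/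
theorem typeIdeal_le_typeLocusIdeal (𝓡 : PolarizedDeformationRing (M.datum S₀ h0 h2 hunr)) :
    M.typeIdeal 𝓡 ≤ M.typeLocusIdeal 𝓡 :=
  le_iInf₂ fun _ hφ => hφ.2

end Model

/-- Unramifiedness passes along a change of coefficients. [folklore] -/
theorem isUnramifiedAt_map {K : Type} [Field K] {A B : Type*} [CommRing A] [CommRing B] (f : A →+* B)
    {n : ℕ} {v : HeightOneSpectrum (𝓞 K)} [NumberField K] {ρ : absoluteGaloisGroup K →* GL (Fin n) A}
    (h : Deformation.IsUnramifiedAt v ρ) :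
    Deformation.IsUnramifiedAt v ((Matrix.GeneralLinearGroup.map f).comp ρ) := by
  intro 𝔓 h𝔓 g hg
  rw [MonoidHom.comp_apply, h 𝔓 h𝔓 g hg, map_one]

/-- `GL_n(f)` is injective for an injective ring map `f`. [folklore] -/
theorem generalLinearGroup_map_injective {A B : Type*} [CommRing A] [CommRing B] {f : A →+* B}
    (hf : Function.Injective f) {n : ℕ} :
    Function.Injective (Matrix.GeneralLinearGroup.map (n := Fin n) f) := by
  intro u w h
  apply Units.ext
  apply Matrix.map_injective hf
  have := congrArg (fun x : GL (Fin n) B => (x : Matrix (Fin n) (Fin n) B)) h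
  simpa using this

/-- The model `σ_𝒪` is unramified wherever `σ` is (`σ(g) = 1 ⇒ P⁻¹ σ(g) P = 1 ⇒ σ_𝒪(g) = 1`).
[folklore] -/
theorem Model.isUnramifiedAt_σ𝒪 {K : Type} [Field K] [NumberField K]
    {σ : FramedGaloisRep K (PadicAlgCl 2) 2} (M : Model σ) {v : HeightOneSpectrum (𝓞 K)}
    (h : σ.IsUnramifiedAt v) : Deformation.IsUnramifiedAt v M.σ𝒪 := by
  have hinj : Function.Injective (O2.incl.comp M.emb) :=
    Subtype.val_injective.comp M.emb_injective
  intro 𝔓 h𝔓 g hg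
  have h1 : σ g = 1 := (FramedGaloisRep.isUnramifiedAt_iff_toMonoidHom v σ).mp h 𝔓 h𝔓 g hg
  apply generalLinearGroup_map_injective hinj
  rw [M.map_σ𝒪 g, h1, mul_one, inv_mul_cancel, map_one]

/-- The residual representation is unramified wherever `σ` is. [folklore] -/
theorem Model.isUnramifiedAt_residual {K : Type} [Field K] [NumberField K]
    {σ : FramedGaloisRep K (PadicAlgCl 2) 2} (M : Model σ) {v : HeightOneSpectrum (𝓞 K)}
    (h : σ.IsUnramifiedAt v) : Deformation.IsUnramifiedAt v M.residual :=
  isUnramifiedAt_map _ (M.isUnramifiedAt_σ𝒪 h)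

/-- REGISTERED SUB-GOAL `squeeze_typeLocusIdeal_le_heckeIdeal` (the order relation the composition
`artinLift_of_squeeze` uses to turn AUT's `dim R ⧸ J_U ≥ 4` into `dim R ⧸ (I^θ ⊔ J_U) ≥ 4`): the Zariski
closure of the type-`θ` Hecke points lies in the type locus, `I^θ ≤ J_U`. [folklore] -/
theorem squeeze_typeLocusIdeal_le_heckeIdeal : ∀ (K : Type) [Field K] [NumberField K]
    (σ : FramedGaloisRep K (PadicAlgCl 2) 2) (M : Model σ) (S₀ : Finset ℕ) (h0 : (0 : ℕ) ∉ S₀) (h2 : 2 ∈ S₀)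
    (hunr : ∀ v ∉ badSet K S₀, Deformation.IsUnramifiedAt v M.residual)
    (𝓡 : PolarizedDeformationRing (M.datum S₀ h0 h2 hunr))
    (U : Subgroup (GL (Fin 2) (FiniteAdeleRing (𝓞 K) K)))
    (ϖ : ∀ v : HeightOneSpectrum (𝓞 K), (v.adicCompletion K)ˣ),
    M.typeLocusIdeal 𝓡 ≤ M.heckeIdeal 𝓡 U ϖ :=
  fun _ _ _ _ M _ _ _ _ 𝓡 U ϖ => M.typeLocusIdeal_le_heckeIdeal 𝓡 U ϖ

end Summit.Langlands.Langlands.Cruxes.TwoAdicBianchiProModularityLevel.DimensionSqueeze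

end
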